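import Mathlib
import Summits.Ventures.HodgeRepro2.T7SupportDominantGeometricSide
import Summits.Ventures.HodgeRepro2.T7SupportArchDecayGlue
import Summits.Ventures.HodgeRepro2.T7SupportExponentNumbers
import Summits.Ventures.HodgeRepro2.Tier7.Line3.AbsSummable
import Summits.Ventures.HodgeRepro2.Tier7.Line3.DenominatorBoundGlue

/-!
# Tier7/Line3/DominantSideOfKappa — the dominant-term package ASSEMBLED from the κ-dictionary (seat t7-x1, gen 2)

LINE 3 (t7-plan-3), version (ii) (L3-ARGUMENT.md §2e / §2f). The obligation shape of the line is p1's
`DominantSide Rep Orb PA PB` (T7SupportDominantGeometricSide, row 674) with its sorry-free chain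
`DominantSide.exists_twoTorus : ∃ π, PA π ∧ PB π`. The memo's §2f «kernel map» says, field by field, which landed row
supplies which analytic field — as a TABLE. This module types the table as ONE theorem: a structure `KappaData`
whose fields are exactly the κ-DICTIONARY items of the right-hand column (the finite-place bounds `hcong` / `hS` /
`hout` on the support of the level-`N` finite test function, the archimedean bound `hT` off the two rank-one places,
the real values `1 ≤ κ` at the two rank-one places and the per-place decays `‖a_j γ‖ ≤ C_j κ_j(γ)^{−k_j/2}` of the
`D_{k_j}` coefficients (`3 ≤ k_j`), the bounded compact-place factor `a₁`, the injectivity of `κ` on the double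
cosets, the finite factors `b` with `b_support` / `b_bound` / `b_γ₀`, the dominant archimedean value `a_γ₀ ≠ 0`, and
the spectral side `spec` with the trace identity), and a `noncomputable def dominantSide : KappaData … → DominantSide …`
in which EVERY analytic field of `DominantSide` is DERIVED:

* `a_bound` — from the two one-place decays (p1 `T7SupportArchDecayGlue` rows 684, `T7SupportExponentNumbers` row 687
  for the common exponent `α = 3/2`); the row-684 lemma has ONE centre `κ₀` for both places, the real size has one
  centre PER PLACE (`κ(γ₀)` embedded at `w₂` and at `w₃` are different reals) — `a_bound_of_two_places_two_centres`
  below is the two-centre form the assembly needs (the one lemma the table elides on the decay side);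
* `count_bound` — L1-p4's `DenominatorBoundGlue.count_bound_of_hS_hout` (p5 `CountBoundOfKappa` fed by p4's
  `DenominatorBound`), `β = 1 + ε`;
* `size_of_arith` — x1's `ProductFormulaSeparation.inv_mul_pow_le_archSizeOn` (the product formula) composed with
  `archSizeOn_pair_le_size`: the product-formula size `∏_{w ∈ {w₂, w₃}} |κ γ − κ γ₀|_w` is at most the
  `(1 + |·|_{w₂})(1 + |·|_{w₃})` size the count and decay rows use (the one lemma the table elides on the size side);
  `ρ N = C⁻¹ q^N → ∞` (`tendsto_inv_mul_pow`);
* `abs_summable` — p5's `AbsSummable.abs_summable_of_fields`;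
* `hαβ` — `(1 + ε) + ε < 3/2` for `ε < 1/4` (row 687 `exponent_condition_iff`).

CONCLUSION: `exists_twoTorus_of_kappaData : ∃ π, PA π ∧ PB π` for every `KappaData`. So the residual (a′) of the
line reads as the FIELDS of `KappaData` (a typed exact statement), not as a table in words. NOTHING here proves any
field of `KappaData` for the real objects (`X`, `U(W_A)`, the tori, the test functions — TYPING-CENSUS T7): the
real values of `κ` at the places, the finite-place bounds on the support, the orbital-integral decays and the trace
identity are displayed hypotheses. Nothing about (N) or HC_CM; §8(d): uses an L-value-free non-vanishing device: NO.
Blind lane: Mathlib + the HodgeRepro2 prefix only; no sorry; axioms ⊆ {propext, Classical.choice, Quot.sound}.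
-/

namespace Summit.Ventures.HodgeRepro2.Tier7.Line3.DominantSideOfKappa

open NumberField Filter Topology
open Summit.Ventures.HodgeRepro2.T7SupportDominantGeometricSide
open Summit.Ventures.HodgeRepro2.T7SupportArchDecayGlue
open Summit.Ventures.HodgeRepro2.T7SupportExponentNumbers
open Summit.Ventures.HodgeRepro2.Tier7.Line3.AbsSummable
open Summit.Ventures.HodgeRepro2.Tier7.Line3.DenominatorBoundGlue
open Summit.Ventures.HodgeRepro2.Tier7.Line3.ProductFormulaSeparation

variable {K : Type*} [Field K] [NumberField K]

/-! ## 1. The real value of `κ` at a real place -/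

/-- the real value of `x : K` at a real infinite place `w` (Mathlib's `embedding_of_isReal`): the number the
rank-one-place rows call `κ_v(γ)` when `x = κ γ`. -/
noncomputable def reAt {w : InfinitePlace K} (hw : w.IsReal) (x : K) : ℝ :=
  InfinitePlace.embedding_of_isReal hw x

omit [NumberField K] in
/-- `|reAt w x| = |x|_w`. -/
theorem abs_reAt {w : InfinitePlace K} (hw : w.IsReal) (x : K) : |reAt hw x| = w x := by
  rw [← Real.norm_eq_abs]
  exact InfinitePlace.norm_embedding_of_isReal hw x

/-- **the real distance at a real place is the place's absolute value of the difference**: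
`|reAt w x − reAt w y| = |x − y|_w`. -/
theorem abs_reAt_sub {w : InfinitePlace K} (hw : w.IsReal) (x y : K) :
    |reAt hw x - reAt hw y| = w (x - y) := by
  rw [← abs_reAt hw (x - y)]
  simp only [reAt, map_sub]

/-! ## 2. The two sizes -/

omit [NumberField K] in
/-- a real place has multiplicity `1`. -/
theorem mult_eq_one_of_isReal {w : InfinitePlace K} (hw : w.IsReal) : w.mult = 1 := by
  unfold InfinitePlace.mult
  exact if_pos hw

/-- the size of a double coset in the count and decay rows: `(1 + |κ γ − κ₀|_{w₂}) (1 + |κ γ − κ₀|_{w₃})`. -/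
noncomputable def size {Orb : Type} (w₂ w₃ : InfinitePlace K) (κ : Orb → K) (κ₀ : K) (γ : Orb) : ℝ :=
  (1 + w₂ (κ γ - κ₀)) * (1 + w₃ (κ γ - κ₀))

omit [NumberField K] in
/-- the size is non-negative. -/
theorem size_nonneg {Orb : Type} (w₂ w₃ : InfinitePlace K) (κ : Orb → K) (κ₀ : K) (γ : Orb) :
    0 ≤ size w₂ w₃ κ κ₀ γ := by
  unfold size
  have h2 := apply_nonneg w₂ (κ γ - κ₀)
  have h3 := apply_nonneg w₃ (κ γ - κ₀)
  positivity

omit [NumberField K] in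
open scoped Classical in
/-- **the product-formula size is at most the count/decay size**: for two distinct real places,
`∏_{w ∈ {w₂, w₃}} |κ γ − κ γ₀|_w^{mult w} ≤ (1 + |κ γ − κ γ₀|_{w₂}) (1 + |κ γ − κ γ₀|_{w₃})`. -/
theorem archSizeOn_pair_le_size {Orb : Type} {w₂ w₃ : InfinitePlace K} (hw₂ : w₂.IsReal) (hw₃ : w₃.IsReal)
    (hw : w₂ ≠ w₃) (κ : Orb → K) (γ₀ γ : Orb) :
    archSizeOn ({w₂, w₃} : Finset (InfinitePlace K)) κ γ₀ γ ≤ size w₂ w₃ κ (κ γ₀) γ := by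
  unfold archSizeOn size
  rw [Finset.prod_pair hw, mult_eq_one_of_isReal hw₂, mult_eq_one_of_isReal hw₃, pow_one, pow_one]
  have h2 := apply_nonneg w₂ (κ γ - κ γ₀)
  have h3 := apply_nonneg w₃ (κ γ - κ γ₀)
  nlinarith

/-! ## 3. The decay in the product size with one centre per place -/

/-- **`a_bound` of the product size from two one-place decays, one centre per place**: with `κ_v ≥ 1`,
`‖a_v γ‖ ≤ C_v κ_v(γ)^{−α}` (`v = 2, 3`, `C_v ≥ 0`) and `α ≥ 0`,
`‖a₂ γ · a₃ γ‖ ≤ C (1 + (1 + |κ₂ γ − c₂|)(1 + |κ₃ γ − c₃|))^{−α}` with `C = C₂ C₃ (2 (2 + |c₂|)(2 + |c₃|))^α`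
(row 684 has `c₂ = c₃`; the real size has the two embeddings of `κ(γ₀)` as centres). -/
theorem a_bound_of_two_places_two_centres {Orb : Type} (a₂ a₃ : Orb → ℂ) (κ₂ κ₃ : Orb → ℝ)
    (hκ₂ : ∀ γ, 1 ≤ κ₂ γ) (hκ₃ : ∀ γ, 1 ≤ κ₃ γ) {α : ℝ} (hα : 0 ≤ α) {C₂ C₃ : ℝ} (hC₂ : 0 ≤ C₂) (hC₃ : 0 ≤ C₃)
    (h₂ : ∀ γ, ‖a₂ γ‖ ≤ C₂ * κ₂ γ ^ (-α)) (h₃ : ∀ γ, ‖a₃ γ‖ ≤ C₃ * κ₃ γ ^ (-α)) (c₂ c₃ : ℝ) :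
    ∀ γ, ‖a₂ γ * a₃ γ‖ ≤
      C₂ * C₃ * (2 * ((2 + |c₂|) * (2 + |c₃|))) ^ α * (1 + (1 + |κ₂ γ - c₂|) * (1 + |κ₃ γ - c₃|)) ^ (-α) := by
  intro γ
  have hx := hκ₂ γ
  have hy := hκ₃ γ
  have hM₂ : 1 ≤ 2 + |c₂| := by have := abs_nonneg c₂; linarith
  have hM₃ : 1 ≤ 2 + |c₃| := by have := abs_nonneg c₃; linarith
  have hM : 1 ≤ (2 + |c₂|) * (2 + |c₃|) := one_le_mul_of_one_le_of_one_le hM₂ hM₃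
  have hsize : (1 + |κ₂ γ - c₂|) * (1 + |κ₃ γ - c₃|) ≤ ((2 + |c₂|) * (2 + |c₃|)) * (κ₂ γ * κ₃ γ) := by
    have e2 := one_add_abs_sub_le hx c₂
    have e3 := one_add_abs_sub_le hy c₃
    have p3 : 0 ≤ 1 + |κ₃ γ - c₃| := by positivity
    have q2 : 0 ≤ (2 + |c₂|) * κ₂ γ := by positivity
    calc (1 + |κ₂ γ - c₂|) * (1 + |κ₃ γ - c₃|) ≤ ((2 + |c₂|) * κ₂ γ) * ((2 + |c₃|) * κ₃ γ) :=
          mul_le_mul e2 e3 p3 q2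
      _ = ((2 + |c₂|) * (2 + |c₃|)) * (κ₂ γ * κ₃ γ) := by ring
  have hs0 : 0 ≤ (1 + |κ₂ γ - c₂|) * (1 + |κ₃ γ - c₃|) := by positivity
  have hkey := rpow_neg_mul_rpow_neg_le hx hy hM hs0 hsize hα
  have hxα : 0 ≤ κ₂ γ ^ (-α) := Real.rpow_nonneg (by linarith) _
  have hyα : 0 ≤ κ₃ γ ^ (-α) := Real.rpow_nonneg (by linarith) _
  calc ‖a₂ γ * a₃ γ‖ = ‖a₂ γ‖ * ‖a₃ γ‖ := norm_mul _ _
    _ ≤ (C₂ * κ₂ γ ^ (-α)) * (C₃ * κ₃ γ ^ (-α)) :=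
        mul_le_mul (h₂ γ) (h₃ γ) (norm_nonneg _) ((norm_nonneg _).trans (h₂ γ))
    _ = (C₂ * C₃) * (κ₂ γ ^ (-α) * κ₃ γ ^ (-α)) := by ring
    _ ≤ (C₂ * C₃) * ((2 * ((2 + |c₂|) * (2 + |c₃|))) ^ α *
          (1 + (1 + |κ₂ γ - c₂|) * (1 + |κ₃ γ - c₃|)) ^ (-α)) :=
        mul_le_mul_of_nonneg_left hkey (mul_nonneg hC₂ hC₃)
    _ = C₂ * C₃ * (2 * ((2 + |c₂|) * (2 + |c₃|))) ^ α *
          (1 + (1 + |κ₂ γ - c₂|) * (1 + |κ₃ γ - c₃|)) ^ (-α) := by ring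

/-! ## 4. The κ-dictionary -/

/-- **THE κ-DICTIONARY** of the version-(ii) line (memo §2f, right-hand column) as displayed fields: an abstract set
`Orb` of double cosets with an invariant `κ : Orb → K` into a totally real number field `K`, injective (p1's
`T7SupportTwoTorusInvariant` rows 662/663 give this for the regular double cosets of a rank-two unitary group over
any field with involution); the distinguished coset `γ₀`; the level-`N` support predicate `arith`; the finite-place
bounds on `κ γ − κ γ₀` over the support — a congruence to depth `N` at `v₁` (`hcong`), bounds at a finite set `S`
(`hS`), integrality elsewhere (`hout`) — and the archimedean bound off the two rank-one places `w₂, w₃` (`hT`); the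
archimedean factors `a₁` (compact place, bounded), `a₂, a₃` (rank-one places: the `D_{k_j}` coefficients, decaying in
the real value of `κ` at the place with exponent `k_j / 2`, `3 ≤ k_j`) with `a_γ₀ ≠ 0`; the finite factors `b` with
`b_support`, `b_bound` (growth exponent `ε < 1/4` relative to `γ₀`) and `b_γ₀`; the spectral side `spec` with the
period-vanishing clauses and the trace identity. Every field is a hypothesis about the real objects that this file
does not prove (TYPING-CENSUS T7). -/
structure KappaData (K : Type*) [Field K] [NumberField K] (Rep Orb : Type) [DecidableEq Orb]
    (PA PB : Rep → Prop) where
  /-- the double-coset invariant -/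
  κ : Orb → K
  /-- `κ` separates the double cosets -/
  hκ : Function.Injective κ
  /-- the distinguished (dominant) double coset -/
  γ₀ : Orb
  /-- «`γ` meets the support of the level-`N` finite test function» -/
  arith : ℕ → Orb → Prop
  /-- the finite place where the level shrinks -/
  v₁ : FinitePlace K
  /-- the finite places with bounded denominators -/
  S : Finset (FinitePlace K)
  hv₁S : v₁ ∉ S
  /-- the residue-size parameter of the congruence at `v₁` -/
  q : ℝ
  hq : 1 < q
  /-- the denominator bounds at `S` -/
  B : FinitePlace K → ℝ
  hBpos : ∀ w ∈ S, 0 < B w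
  /-- the congruence at `v₁` on the support: `|κ γ − κ γ₀|_{v₁} ≤ q^{−N}` -/
  hcong : ∀ N γ, arith N γ → v₁ (κ γ - κ γ₀) ≤ q⁻¹ ^ N
  /-- bounded denominators at `S` on the support -/
  hS : ∀ N γ, arith N γ → ∀ w ∈ S, w (κ γ - κ γ₀) ≤ B w
  /-- integrality at every other finite place on the support -/
  hout : ∀ N γ, arith N γ → ∀ w, w ∉ S → w ≠ v₁ → w (κ γ - κ γ₀) ≤ 1
  /-- `K` is totally real -/
  hK : ∀ w : InfinitePlace K, w.IsReal
  /-- the first rank-one place -/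
  w₂ : InfinitePlace K
  /-- the second rank-one place -/
  w₃ : InfinitePlace K
  hw : w₂ ≠ w₃
  /-- the archimedean bound off `{w₂, w₃}` -/
  Binf : ℝ
  hBinf : 0 < Binf
  /-- `|κ γ − κ γ₀|_w ≤ Binf` at every infinite place other than `w₂, w₃` on the support (the definite places) -/
  hT : ∀ N γ, arith N γ → ∀ w : InfinitePlace K, w ≠ w₂ → w ≠ w₃ → w (κ γ - κ γ₀) ≤ Binf
  /-- the archimedean factor at the compact place -/
  a₁ : Orb → ℂ
  /-- the archimedean factor at the first rank-one place -/
  a₂ : Orb → ℂ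
  /-- the archimedean factor at the second rank-one place -/
  a₃ : Orb → ℂ
  /-- the bound of the compact-place factor -/
  C₁ : ℝ
  ha₁ : ∀ γ, ‖a₁ γ‖ ≤ C₁
  /-- the real value of `κ` at a rank-one place is `≥ 1` -/
  one_le_κ₂ : ∀ γ, 1 ≤ reAt (hK w₂) (κ γ)
  one_le_κ₃ : ∀ γ, 1 ≤ reAt (hK w₃) (κ γ)
  /-- the weights at the rank-one places -/
  k₂ : ℕ
  k₃ : ℕ
  hk₂ : 3 ≤ k₂
  hk₃ : 3 ≤ k₃
  /-- the decay constants -/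
  C₂ : ℝ
  C₃ : ℝ
  hC₂ : 0 ≤ C₂
  hC₃ : 0 ≤ C₃
  /-- the decay of the rank-one-place factors in the real value of `κ`: exponent `k_j / 2` -/
  ha₂ : ∀ γ, ‖a₂ γ‖ ≤ C₂ * reAt (hK w₂) (κ γ) ^ (-((k₂ : ℝ) / 2))
  ha₃ : ∀ γ, ‖a₃ γ‖ ≤ C₃ * reAt (hK w₃) (κ γ) ^ (-((k₃ : ℝ) / 2))
  /-- the dominant archimedean value is non-zero -/
  a_γ₀ : a₁ γ₀ * a₂ γ₀ * a₃ γ₀ ≠ 0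
  /-- the growth exponent of the finite factors -/
  ε : ℝ
  hε : 0 < ε
  hε' : ε < 1 / 4
  /-- the finite-place factor at level `N` -/
  b : ℕ → Orb → ℂ
  b_support : ∀ N γ, b N γ ≠ 0 → arith N γ
  /-- the finite factor grows at most like `size^ε` relative to the dominant coset -/
  b_bound : ∃ Bb : ℝ, ∀ N γ, arith N γ → ‖b N γ‖ ≤ Bb * (1 + size w₂ w₃ κ (κ γ₀) γ) ^ ε * ‖b N γ₀‖
  /-- the dominant finite factor is non-zero for `N` large -/
  b_γ₀ : ∃ N₀ : ℕ, ∀ N ≥ N₀, b N γ₀ ≠ 0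
  /-- the spectral term of level `N` at `π` -/
  spec : ℕ → Rep → ℂ
  spec_zero_A : ∀ N π, ¬ PA π → spec N π = 0
  spec_zero_B : ∀ N π, ¬ PB π → spec N π = 0
  /-- THE TRACE IDENTITY: geometric side = spectral side -/
  identity : ∀ N, ∑' γ, a₁ γ * a₂ γ * a₃ γ * b N γ = ∑' π, spec N π

namespace KappaData

variable {Rep Orb : Type} [DecidableEq Orb] {PA PB : Rep → Prop} (D : KappaData K Rep Orb PA PB)

/-- the archimedean factor `a = a₁ a₂ a₃` -/
noncomputable def a (γ : Orb) : ℂ := D.a₁ γ * D.a₂ γ * D.a₃ γ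

/-- the size of a double coset, centred at `γ₀` -/
noncomputable def sz (γ : Orb) : ℝ := size D.w₂ D.w₃ D.κ (D.κ D.γ₀) γ

/-- the size is `(1 + |κ₂ γ − κ₂ γ₀|)(1 + |κ₃ γ − κ₃ γ₀|)` in the real values. -/
theorem sz_eq (γ : Orb) :
    D.sz γ = (1 + |reAt (D.hK D.w₂) (D.κ γ) - reAt (D.hK D.w₂) (D.κ D.γ₀)|) *
      (1 + |reAt (D.hK D.w₃) (D.κ γ) - reAt (D.hK D.w₃) (D.κ D.γ₀)|) := by
  unfold sz size
  rw [abs_reAt_sub, abs_reAt_sub]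

/-- the `a_bound` field: decay of exponent `3/2` in the size. -/
theorem a_bound : ∃ C : ℝ, ∀ γ, ‖D.a γ‖ ≤ C * (1 + D.sz γ) ^ (-(3 / 2 : ℝ)) := by
  have h2 := decay_of_weight_ge D.a₂ (fun γ => reAt (D.hK D.w₂) (D.κ γ)) D.one_le_κ₂ D.hC₂ D.hk₂ D.ha₂
  have h3 := decay_of_weight_ge D.a₃ (fun γ => reAt (D.hK D.w₃) (D.κ γ)) D.one_le_κ₃ D.hC₃ D.hk₃ D.ha₃
  have e : ((3 : ℕ) : ℝ) / 2 = 3 / 2 := by norm_num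
  rw [e] at h2 h3
  have h23 := a_bound_of_two_places_two_centres D.a₂ D.a₃ (fun γ => reAt (D.hK D.w₂) (D.κ γ))
    (fun γ => reAt (D.hK D.w₃) (D.κ γ)) D.one_le_κ₂ D.one_le_κ₃ (by norm_num : (0 : ℝ) ≤ 3 / 2) D.hC₂ D.hC₃
    h2 h3 (reAt (D.hK D.w₂) (D.κ D.γ₀)) (reAt (D.hK D.w₃) (D.κ D.γ₀))
  obtain ⟨C, hC⟩ := exists_a_bound_of_bounded_mul D.a₁ (fun γ => D.a₂ γ * D.a₃ γ) D.sz (3 / 2)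
    ⟨D.C₁, D.ha₁⟩ ⟨_, fun γ => by rw [sz_eq]; exact h23 γ⟩
  refine ⟨C, fun γ => ?_⟩
  have : D.a γ = D.a₁ γ * (D.a₂ γ * D.a₃ γ) := mul_assoc _ _ _
  rw [this]
  exact hC γ

/-- the `count_bound` field, from L1-p4's glue of the count and denominator rows. -/
theorem count_bound : ∃ C' : ℝ, ∀ N (R : ℝ), 0 ≤ R →
    ∃ s : Finset Orb, (∀ γ, D.arith N γ → D.sz γ ≤ R → γ ∈ s) ∧ (s.card : ℝ) ≤ C' * (1 + R) ^ (1 + D.ε) :=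
  count_bound_of_hS_hout D.hK D.hw D.hε D.hBinf.le D.κ D.hκ (D.κ D.γ₀) D.arith D.v₁ D.S D.hq D.B D.hcong
    D.hS D.hout D.hT

/-- the size threshold: an explicit `C > 0` with `C⁻¹ q^N ≤ sz γ` on the support off `γ₀`, from the product
formula (x1's row) and `archSizeOn_pair_le_size`. -/
theorem exists_size_threshold : ∃ C : ℝ, 0 < C ∧
    ∀ N γ, D.arith N γ → γ ≠ D.γ₀ → C⁻¹ * D.q ^ N ≤ D.sz γ := by
  classical
  have hBinf : ∀ w ∉ ({D.w₂, D.w₃} : Finset (InfinitePlace K)), 0 < (fun _ => D.Binf) w :=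
    fun _ _ => D.hBinf
  have hT : ∀ N γ, D.arith N γ → ∀ w ∉ ({D.w₂, D.w₃} : Finset (InfinitePlace K)),
      w (D.κ γ - D.κ D.γ₀) ≤ (fun _ => D.Binf) w := by
    intro N γ hγ w hw
    simp only [Finset.mem_insert, Finset.mem_singleton, not_or] at hw
    exact D.hT N γ hγ w hw.1 hw.2
  have hsep : ∀ γ, D.κ γ = D.κ D.γ₀ → γ = D.γ₀ := fun γ h => D.hκ h
  have key := inv_mul_pow_le_archSizeOn D.κ D.γ₀ D.arith D.v₁ D.S D.hv₁S D.hq D.B D.hBpos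
    ({D.w₂, D.w₃} : Finset (InfinitePlace K)) (fun _ => D.Binf) hBinf D.hcong D.hS D.hout hT hsep
  refine ⟨(∏ w ∈ D.S, D.B w) * ∏ w ∈ ({D.w₂, D.w₃} : Finset (InfinitePlace K))ᶜ, (fun _ => D.Binf) w ^ w.mult,
    ?_, fun N γ hγ hne => (key N γ hγ hne).trans ?_⟩
  · exact mul_pos (Finset.prod_pos D.hBpos) (Finset.prod_pos fun w _ => pow_pos D.hBinf _)
  · exact archSizeOn_pair_le_size (D.hK D.w₂) (D.hK D.w₃) D.hw D.κ D.γ₀ γ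

/-- the threshold constant (chosen from `exists_size_threshold`) -/
noncomputable def thresholdC : ℝ := Classical.choose D.exists_size_threshold

/-- the threshold constant is positive -/
theorem thresholdC_pos : 0 < D.thresholdC := (Classical.choose_spec D.exists_size_threshold).1

/-- the threshold constant works: `C⁻¹ q^N ≤ sz γ` on the support off `γ₀` -/
theorem thresholdC_spec : ∀ N γ, D.arith N γ → γ ≠ D.γ₀ → D.thresholdC⁻¹ * D.q ^ N ≤ D.sz γ :=
  (Classical.choose_spec D.exists_size_threshold).2

/-- the size threshold `ρ N = C⁻¹ q^N` -/
noncomputable def ρ (N : ℕ) : ℝ := D.thresholdC⁻¹ * D.q ^ N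

/-- `ρ N → ∞` -/
theorem tendsto_ρ : Tendsto D.ρ atTop atTop := tendsto_inv_mul_pow D.thresholdC_pos D.hq

/-- the exponent condition `β + d′ < α` with `β = 1 + ε`, `d′ = ε`, `α = 3/2` -/
theorem exponent_condition : (1 + D.ε) + D.ε < 3 / 2 := (exponent_condition_iff D.ε).2 D.hε'

/-- the `b_bound` field in the size `sz` -/
theorem b_bound' : ∃ Bb : ℝ, ∀ N γ, D.arith N γ → ‖D.b N γ‖ ≤ Bb * (1 + D.sz γ) ^ D.ε * ‖D.b N D.γ₀‖ :=
  D.b_bound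

/-! ## 5. The assembly -/

/-- **THE DOMINANT-TERM PACKAGE FROM THE κ-DICTIONARY**: every analytic field of p1's `DominantSide` (row 674) is
derived from the fields of `KappaData` — `a_bound` (rows 684/687, two centres), `count_bound` (L1-p4 / p5 / p4),
`size_of_arith` (x1's product formula + `archSizeOn_pair_le_size`), `abs_summable` (p5), `hαβ` (row 687) — with
`size = sz`, `α = 3/2`, `β = 1 + ε`, `d′ = ε`, `ρ N = C⁻¹ q^N`. -/
noncomputable def dominantSide : DominantSide Rep Orb PA PB where
  spec := D.spec
  spec_zero_A := D.spec_zero_A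
  spec_zero_B := D.spec_zero_B
  a := D.a
  b := D.b
  orb := fun N γ => D.a γ * D.b N γ
  orb_eq := fun _ _ => rfl
  abs_summable := abs_summable_of_fields D.a D.b (fun N γ => D.a γ * D.b N γ) (fun _ _ => rfl) D.sz
    (fun γ => size_nonneg _ _ _ _ γ) D.arith D.b_support (α := 3 / 2) (β := 1 + D.ε) (d' := D.ε)
    (by linarith [D.hε]) D.exponent_condition D.a_bound D.γ₀ D.count_bound D.b_bound'
  identity := D.identity
  γ₀ := D.γ₀
  size := D.sz
  size_nonneg := fun γ => size_nonneg _ _ _ _ γ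
  arith := D.arith
  b_support := D.b_support
  α := 3 / 2
  β := 1 + D.ε
  d' := D.ε
  hβ := by linarith [D.hε]
  hd' := D.hε.le
  hαβ := D.exponent_condition
  a_bound := D.a_bound
  ρ := D.ρ
  hρ := D.tendsto_ρ
  size_of_arith := D.thresholdC_spec
  count_bound := D.count_bound
  b_bound := D.b_bound'
  a_γ₀ := D.a_γ₀
  b_γ₀ := D.b_γ₀

/-- **THE TWO-PERIOD CONCLUSION FROM THE κ-DICTIONARY**: some `π` has both periods. -/
theorem exists_twoTorus_of_kappaData (D : KappaData K Rep Orb PA PB) : ∃ π, PA π ∧ PB π :=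
  DominantSide.exists_twoTorus (dominantSide D)

/-- the geometric side is non-zero at some level, from the κ-dictionary. -/
theorem exists_geom_ne_zero_of_kappaData : ∃ N, ∑' γ, D.a γ * D.b N γ ≠ 0 :=
  DominantSide.exists_geom_ne_zero (dominantSide D)

end KappaData

end Summit.Ventures.HodgeRepro2.Tier7.Line3.DominantSideOfKappa
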